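import Mathlib.Analysis.Convex.SimplicialComplex.Basic
import Mathlib.Analysis.Normed.Affine.AddTorsorBases
import Mathlib.LinearAlgebra.AffineSpace.FiniteDimensional
import Mathlib.Analysis.Normed.Module.FiniteDimension
import HarnessLib

/-!
# The two top cofaces of a codimension-one simplex, and the half-balls they contain

Topic `Literature/Topology/FourManifolds` (convex geometry of simplicial complexes); input of the
codimension-one stage of the smoothing sweep (Munkres, Ann. of Math. 72 (1960), §2: "each
`(n-1)`-simplex of the interior is a face of exactly two `n`-simplices").  Let `b` be an affine
basis of the `n`-dimensional space `E` and `i₀` an index; the points `b i`, `i ≠ i₀`, span a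
hyperplane facet, `b.coord i₀` is the signed height over it, and a point `x₀` of the hyperplane
with `b.coord i x₀ > 0` for all `i ≠ i₀` is a relatively interior point of the facet.

* `mem_convexHull_insert_of_coord` (and `_uniform`, `_close`) — **the half-ball lemma**: for any apex `p` off the
  hyperplane there is `δ > 0` such that every `y` with `dist y x₀ < δ` on the side of `p`
  (`0 ≤ b.coord i₀ y / b.coord i₀ p`) lies in `conv (insert p facet)` (explicit barycentric
  weights `coord_i y - λ coord_i p`, `λ = coord_{i₀} y / coord_{i₀} p`);
* `exists_coface_of_sign` — in a finite simplicial complex `K` whose underlying space is a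
  neighbourhood of such a point `x₀` of a face `s` equal to the facet, for each sign `σ = ±1`
  there is a face `insert p s ∈ K` with `σ b.coord i₀ p > 0` (points `x₀ ± ε (b i₀ - x₀)` lie in
  `|K|`; a face containing them for arbitrarily small `ε` contains `x₀`, hence `s`, since `x₀`
  has positive coordinates; it has a vertex on the right side).

Together: the facet has an upper and a lower top coface, and the union of the two closed
simplices is a neighbourhood of `x₀` — the geometric input of the crease normal form
(`CreaseStage.lean`).  Everything is proved; no definitions besides the abbreviation `facet`;
no named facts.

## References

* J. R. Munkres, *Obstructions to the smoothing of piecewise-differentiable homeomorphisms*, Ann.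
  of Math. (2) 72 (1960), 521–554, §2. [Munkres1960]
-/

noncomputable section

open Set Function Metric Filter
open scoped Topology

namespace Literature.Topology.FourManifolds

variable {E : Type*} [NormedAddCommGroup E] [NormedSpace ℝ E] [FiniteDimensional ℝ E]
variable {ι : Type*} [Fintype ι] [DecidableEq ι]

/-- The facet of an affine basis opposite to the vertex `i₀`, as a finite set of points.
[folklore] -/
def facet [DecidableEq E] (b : AffineBasis ι ℝ E) (i₀ : ι) : Finset E :=
  (Finset.univ.filter fun i => i ≠ i₀).image b

omit [FiniteDimensional ℝ E] in
/-- Membership in the facet. [folklore] -/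
theorem mem_facet_iff [DecidableEq E] {b : AffineBasis ι ℝ E} {i₀ : ι} {v : E} :
    v ∈ facet b i₀ ↔ ∃ i, i ≠ i₀ ∧ b i = v := by
  simp [facet]

omit [FiniteDimensional ℝ E] in
/-- The height coordinate vanishes on the facet. [folklore] -/
theorem coord_eq_zero_of_mem_facet [DecidableEq E] {b : AffineBasis ι ℝ E} {i₀ : ι} {v : E}
    (hv : v ∈ facet b i₀) : b.coord i₀ v = 0 := by
  obtain ⟨i, hi, rfl⟩ := mem_facet_iff.1 hv
  exact b.coord_apply_ne hi.symm

omit [FiniteDimensional ℝ E] in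
/-- The height coordinate vanishes on the closed facet. [folklore] -/
theorem coord_eq_zero_of_mem_convexHull_facet [DecidableEq E] {b : AffineBasis ι ℝ E} {i₀ : ι}
    {x : E} (hx : x ∈ convexHull ℝ (facet b i₀ : Set E)) : b.coord i₀ x = 0 := by
  have hconv : Convex ℝ {y : E | b.coord i₀ y = 0} := by
    intro y hy z hz a c ha hc hac
    simp only [mem_setOf_eq] at hy hz ⊢
    rw [Convex.combo_affine_apply hac, hy, hz]; simp
  exact convexHull_min (fun v hv => coord_eq_zero_of_mem_facet (Finset.mem_coe.1 hv)) hconv hx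

omit [FiniteDimensional ℝ E] in
/-- A coordinate `i ≠ i₀` vanishes on the closed hull of the facet minus `b i`. [folklore] -/
theorem coord_eq_zero_of_mem_convexHull_erase [DecidableEq E] {b : AffineBasis ι ℝ E} {i₀ i : ι}
    {x : E} (hx : x ∈ convexHull ℝ (((facet b i₀).erase (b i) : Finset E) : Set E)) :
    b.coord i x = 0 := by
  have hconv : Convex ℝ {y : E | b.coord i y = 0} := by
    intro y hy z hz a c ha hc hac
    simp only [mem_setOf_eq] at hy hz ⊢
    rw [Convex.combo_affine_apply hac, hy, hz]; simp
  refine convexHull_min (fun v hv => ?_) hconv hx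
  obtain ⟨hne, hv⟩ := Finset.mem_erase.1 (Finset.mem_coe.1 hv)
  obtain ⟨j, -, rfl⟩ := mem_facet_iff.1 hv
  exact b.coord_apply_ne fun h => hne (by rw [h])

/-! ### The half-ball lemma -/

omit [FiniteDimensional ℝ E] in
/-- **The half-ball lemma, algebraic core.** If `x₀` lies on the hyperplane of the facet with
facet coordinates `≥ m₀ > 0`, `p` is off the hyperplane with `|coord_i p| ≤ C - 1`, and the
coordinates of `y` are within `min (m₀/2) (m₀ |coord_{i₀} p| / (2C))` of those of `x₀`, then on
the side of `p` the point `y` lies in `conv (insert p facet)` (explicit barycentric weights).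
[folklore] -/
theorem mem_convexHull_insert_of_coord_close [DecidableEq E] (b : AffineBasis ι ℝ E) (i₀ : ι)
    {x₀ : E} (hx₀ : b.coord i₀ x₀ = 0) {m₀ : ℝ} (hm₀ : 0 < m₀)
    (hm₀le : ∀ i, i ≠ i₀ → m₀ ≤ b.coord i x₀) {p : E} (hp : b.coord i₀ p ≠ 0) {C : ℝ}
    (hC1 : ∀ i, |b.coord i p| ≤ C - 1) {y : E}
    (hyc : ∀ i, |b.coord i y - b.coord i x₀| < min (m₀ / 2) (m₀ * |b.coord i₀ p| / (2 * C)))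
    (hside : 0 ≤ b.coord i₀ y / b.coord i₀ p) :
    y ∈ convexHull ℝ ((insert p (facet b i₀) : Finset E) : Set E) := by
  have hC0 : 0 < C := by linarith [hC1 i₀, abs_nonneg (b.coord i₀ p)]
  -- the weights
  set lam : ℝ := b.coord i₀ y / b.coord i₀ p with hlam
  have hlam0 : 0 ≤ lam := hside
  have hlamkey : lam * b.coord i₀ p = b.coord i₀ y := by rw [hlam, div_mul_cancel₀ _ hp]
  have hlamC : lam * (C - 1) ≤ m₀ / 2 := by
    have h1 : |b.coord i₀ y| < min (m₀ / 2) (m₀ * |b.coord i₀ p| / (2 * C)) := by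
      simpa [hx₀] using hyc i₀
    have h2 : |b.coord i₀ y| ≤ m₀ * |b.coord i₀ p| / (2 * C) := h1.le.trans (min_le_right _ _)
    have hlamabs : lam ≤ m₀ / (2 * C) := by
      have : lam = |lam| := (abs_of_nonneg hlam0).symm
      rw [this, hlam, abs_div, div_le_div_iff₀ (abs_pos.2 hp) (by positivity)]
      calc |b.coord i₀ y| * (2 * C) ≤ m₀ * |b.coord i₀ p| / (2 * C) * (2 * C) := by gcongr
        _ = m₀ * |b.coord i₀ p| := by field_simp
    calc lam * (C - 1) ≤ m₀ / (2 * C) * (C - 1) := by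
          gcongr; linarith [hC1 i₀, abs_nonneg (b.coord i₀ p)]
      _ ≤ m₀ / (2 * C) * C := by gcongr; linarith
      _ = m₀ / 2 := by field_simp
  set W : ι → ℝ := fun i => if i = i₀ then lam else b.coord i y - lam * b.coord i p with hW
  set Z : ι → E := fun i => if i = i₀ then p else b i with hZ
  have hWnonneg : ∀ i, 0 ≤ W i := by
    intro i
    by_cases hi : i = i₀
    · simp [hW, hi, hlam0]
    · simp only [hW, if_neg hi]
      have h1 : m₀ / 2 ≤ b.coord i y := by
        have := hyc i; rw [abs_lt] at this
        linarith [hm₀le i hi, min_le_left (m₀ / 2) (m₀ * |b.coord i₀ p| / (2 * C))]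
      have h2 : lam * b.coord i p ≤ m₀ / 2 :=
        calc lam * b.coord i p ≤ lam * |b.coord i p| := by gcongr; exact le_abs_self _
          _ ≤ lam * (C - 1) := by gcongr; exact hC1 i
          _ ≤ m₀ / 2 := hlamC
      linarith
  have hmemE : ∀ i, i ∈ Finset.univ.erase i₀ ↔ i ≠ i₀ := fun i => by simp
  have hWsum : ∑ i, W i = 1 := by
    rw [← Finset.add_sum_erase _ _ (Finset.mem_univ i₀)]
    simp only [hW, if_pos rfl]
    have h1 : ∑ i ∈ Finset.univ.erase i₀, (if i = i₀ then lam else b.coord i y - lam * b.coord i p) =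
        ∑ i ∈ Finset.univ.erase i₀, (b.coord i y - lam * b.coord i p) :=
      Finset.sum_congr rfl fun i hi => by rw [if_neg ((hmemE i).1 hi)]
    rw [h1, Finset.sum_sub_distrib, ← Finset.mul_sum]
    have hy1 : ∑ i ∈ Finset.univ.erase i₀, b.coord i y = 1 - b.coord i₀ y := by
      have := b.sum_coord_apply_eq_one y
      rw [← Finset.add_sum_erase _ _ (Finset.mem_univ i₀)] at this; linarith
    have hp1 : ∑ i ∈ Finset.univ.erase i₀, b.coord i p = 1 - b.coord i₀ p := by
      have := b.sum_coord_apply_eq_one p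
      rw [← Finset.add_sum_erase _ _ (Finset.mem_univ i₀)] at this; linarith
    rw [hy1, hp1]
    linear_combination hlamkey
  have hWZ : ∑ i, W i • Z i = y := by
    rw [← Finset.add_sum_erase _ _ (Finset.mem_univ i₀)]
    simp only [hW, hZ, if_pos rfl]
    have h1 : ∑ i ∈ Finset.univ.erase i₀,
        (if i = i₀ then lam else b.coord i y - lam * b.coord i p) • (if i = i₀ then p else b i) =
        ∑ i ∈ Finset.univ.erase i₀, (b.coord i y • b i - lam • (b.coord i p • b i)) :=
      Finset.sum_congr rfl fun i hi => by
        rw [if_neg ((hmemE i).1 hi), if_neg ((hmemE i).1 hi), sub_smul, mul_smul]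
    rw [h1, Finset.sum_sub_distrib, ← Finset.smul_sum]
    have hy1 : ∑ i ∈ Finset.univ.erase i₀, b.coord i y • b i = y - b.coord i₀ y • b i₀ := by
      have := b.linear_combination_coord_eq_self y
      rw [← Finset.add_sum_erase _ _ (Finset.mem_univ i₀)] at this
      exact eq_sub_of_add_eq' this
    have hp1 : ∑ i ∈ Finset.univ.erase i₀, b.coord i p • b i = p - b.coord i₀ p • b i₀ := by
      have := b.linear_combination_coord_eq_self p
      rw [← Finset.add_sum_erase _ _ (Finset.mem_univ i₀)] at this
      exact eq_sub_of_add_eq' this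
    rw [hy1, hp1, smul_sub, smul_smul, hlamkey]
    module
  -- conclude by convexity
  rw [← hWZ]
  refine (convex_convexHull ℝ _).sum_mem (fun i _ => hWnonneg i) hWsum fun i _ => ?_
  apply subset_convexHull
  by_cases hi : i = i₀
  · simp [hZ, hi]
  · simp only [hZ, if_neg hi, Finset.coe_insert, mem_insert_iff, Finset.mem_coe]
    exact Or.inr (mem_facet_iff.2 ⟨i, hi, rfl⟩)

omit [FiniteDimensional ℝ E] [DecidableEq ι] in
/-- A uniform bound for the coordinates of an apex: `|coord_i p| ≤ C - 1` for all `i`.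
[folklore] -/
theorem exists_coord_abs_le (b : AffineBasis ι ℝ E) (i₀ : ι) (p : E) :
    ∃ C : ℝ, 0 < C ∧ ∀ i, |b.coord i p| ≤ C - 1 := by
  obtain ⟨j', -, hj'max⟩ :=
    Finset.univ.exists_max_image (fun i => |b.coord i p|) ⟨i₀, Finset.mem_univ _⟩
  exact ⟨|b.coord j' p| + 1, by positivity, fun i => by linarith [hj'max i (Finset.mem_univ i)]⟩

omit [DecidableEq ι] in
/-- **The coordinates are uniformly Lipschitz**: there is `B > 0` with
`|coord_i y - coord_i x| ≤ B · dist y x` for all `i`, `x`, `y`. [folklore] -/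
theorem exists_coord_sub_le_mul_dist (b : AffineBasis ι ℝ E) (i₀ : ι) :
    ∃ B : ℝ, 0 < B ∧ ∀ (i : ι) (x y : E), |b.coord i y - b.coord i x| ≤ B * dist y x := by
  set L : ι → E →L[ℝ] ℝ := fun i => LinearMap.toContinuousLinearMap (b.coord i).linear with hL
  obtain ⟨j, -, hjmax⟩ := Finset.univ.exists_max_image (fun i => ‖L i‖) ⟨i₀, Finset.mem_univ _⟩
  refine ⟨‖L j‖ + 1, by positivity, fun i x y => ?_⟩
  have hlin : b.coord i y - b.coord i x = L i (y - x) := by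
    have := (b.coord i).linearMap_vsub y x
    simp only [vsub_eq_sub] at this
    rw [← this]; rfl
  rw [hlin, ← Real.norm_eq_abs, dist_eq_norm]
  calc ‖L i (y - x)‖ ≤ ‖L i‖ * ‖y - x‖ := (L i).le_opNorm _
    _ ≤ (‖L j‖ + 1) * ‖y - x‖ := by
        gcongr; linarith [hjmax i (Finset.mem_univ i)]

/-- **The half-ball lemma.** Let `x₀` lie on the hyperplane of the facet opposite `i₀`
(`b.coord i₀ x₀ = 0`) with all facet coordinates positive, and `p` a point off the hyperplane.
Then near `x₀`, every point on the side of `p` lies in the closed simplex `conv (insert p facet)`.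
[folklore] -/
theorem mem_convexHull_insert_of_coord [DecidableEq E] (b : AffineBasis ι ℝ E) (i₀ : ι) {x₀ : E}
    (hx₀ : b.coord i₀ x₀ = 0) (hpos : ∀ i, i ≠ i₀ → 0 < b.coord i x₀) {p : E}
    (hp : b.coord i₀ p ≠ 0) :
    ∃ δ : ℝ, 0 < δ ∧ ∀ y : E, dist y x₀ < δ → 0 ≤ b.coord i₀ y / b.coord i₀ p →
      y ∈ convexHull ℝ ((insert p (facet b i₀) : Finset E) : Set E) := by
  -- the positivity margin `m₀`
  obtain ⟨m₀, hm₀, hm₀le⟩ : ∃ m₀ : ℝ, 0 < m₀ ∧ ∀ i, i ≠ i₀ → m₀ ≤ b.coord i x₀ := by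
    by_cases hne : (Finset.univ.filter fun i => i ≠ i₀).Nonempty
    · obtain ⟨j, hj, hjmin⟩ :=
        (Finset.univ.filter fun i => i ≠ i₀).exists_min_image (fun i => b.coord i x₀) hne
      refine ⟨b.coord j x₀, hpos j (Finset.mem_filter.1 hj).2, fun i hi => ?_⟩
      exact hjmin i (Finset.mem_filter.2 ⟨Finset.mem_univ _, hi⟩)
    · exact ⟨1, one_pos, fun i hi =>
        absurd ⟨i, Finset.mem_filter.2 ⟨Finset.mem_univ _, hi⟩⟩ hne⟩
  obtain ⟨C, hC0, hC1⟩ := exists_coord_abs_le b i₀ p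
  obtain ⟨B, hB, hBle⟩ := exists_coord_sub_le_mul_dist b i₀
  set η : ℝ := min (m₀ / 2) (m₀ * |b.coord i₀ p| / (2 * C)) with hη
  have hη0 : 0 < η := by
    rw [hη, lt_min_iff]; exact ⟨by positivity, by positivity⟩
  refine ⟨η / B, by positivity, fun y hy hside => ?_⟩
  refine mem_convexHull_insert_of_coord_close b i₀ hx₀ hm₀ hm₀le hp hC1 (fun i => ?_) hside
  calc |b.coord i y - b.coord i x₀| ≤ B * dist y x₀ := hBle i x₀ y
    _ < B * (η / B) := by gcongr
    _ = η := by field_simp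

/-- **The half-ball lemma, uniform version**: for a fixed positivity margin `m₀` and apex `p`,
one `δ` works for all base points `x₀` of the hyperplane with facet coordinates `≥ m₀`.
[folklore] -/
theorem mem_convexHull_insert_of_coord_uniform [DecidableEq E] (b : AffineBasis ι ℝ E) (i₀ : ι)
    {m₀ : ℝ} (hm₀ : 0 < m₀) {p : E} (hp : b.coord i₀ p ≠ 0) :
    ∃ δ : ℝ, 0 < δ ∧ ∀ x₀ : E, b.coord i₀ x₀ = 0 → (∀ i, i ≠ i₀ → m₀ ≤ b.coord i x₀) →
      ∀ y : E, dist y x₀ < δ → 0 ≤ b.coord i₀ y / b.coord i₀ p →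
        y ∈ convexHull ℝ ((insert p (facet b i₀) : Finset E) : Set E) := by
  obtain ⟨C, hC0, hC1⟩ := exists_coord_abs_le b i₀ p
  obtain ⟨B, hB, hBle⟩ := exists_coord_sub_le_mul_dist b i₀
  set η : ℝ := min (m₀ / 2) (m₀ * |b.coord i₀ p| / (2 * C)) with hη
  have hη0 : 0 < η := by
    rw [hη, lt_min_iff]; exact ⟨by positivity, by positivity⟩
  refine ⟨η / B, by positivity, fun x₀ hx₀ hm₀le y hy hside => ?_⟩
  refine mem_convexHull_insert_of_coord_close b i₀ hx₀ hm₀ hm₀le hp hC1 (fun i => ?_) hside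
  calc |b.coord i y - b.coord i x₀| ≤ B * dist y x₀ := hBle i x₀ y
    _ < B * (η / B) := by gcongr
    _ = η := by field_simp

/-! ### Existence of a coface on each side -/

omit [FiniteDimensional ℝ E] in
/-- **A coface on each side.** Let `K` be a finite simplicial complex, `s ∈ K` the facet of the
affine basis `b` opposite `i₀`, and `x₀ ∈ conv s` a point with positive facet coordinates such
that `|K|` is a neighbourhood of `x₀`.  Then for each sign `σ = ±1` there is `p` with
`insert p s ∈ K` and `σ · b.coord i₀ p > 0`. [cite: Munkres1960, §2] -/
theorem exists_coface_of_sign [DecidableEq E] {K : Geometry.SimplicialComplex ℝ E}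
    (hK : K.faces.Finite) (b : AffineBasis ι ℝ E) (i₀ : ι) (hs : facet b i₀ ∈ K.faces) {x₀ : E}
    (hx₀s : x₀ ∈ convexHull ℝ (facet b i₀ : Set E)) (hpos : ∀ i, i ≠ i₀ → 0 < b.coord i x₀)
    (hnhds : K.space ∈ 𝓝 x₀) {σ : ℝ} (hσ : σ = 1 ∨ σ = -1) :
    ∃ p : E, insert p (facet b i₀) ∈ K.faces ∧ 0 < σ * b.coord i₀ p := by
  have hx₀ : b.coord i₀ x₀ = 0 := coord_eq_zero_of_mem_convexHull_facet hx₀s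
  have hσ0 : σ ≠ 0 := by rcases hσ with rfl | rfl <;> norm_num
  have hσsq : σ * σ = 1 := by rcases hσ with rfl | rfl <;> norm_num
  -- the probing path and its height
  set γ : ℝ → E := fun r => AffineMap.lineMap x₀ (b i₀) (σ * r) with hγ
  have hγc : Continuous γ := AffineMap.lineMap_continuous.comp (continuous_const.mul continuous_id)
  have hγ0 : γ 0 = x₀ := by simp [hγ]
  have hℓγ : ∀ r, b.coord i₀ (γ r) = σ * r := fun r => by
    simp only [hγ, AffineMap.apply_lineMap, hx₀, b.coord_apply_eq, AffineMap.lineMap_apply_ring']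
    ring
  -- a parameter interval mapped into `|K|`
  obtain ⟨r₀, hr₀, hr₀sub⟩ : ∃ r₀ > 0, ∀ r, |r| ≤ r₀ → γ r ∈ K.space := by
    have := hγc.continuousAt.preimage_mem_nhds (by rw [hγ0]; exact hnhds)
    obtain ⟨ε, hε, hball⟩ := Metric.mem_nhds_iff.1 this
    refine ⟨ε / 2, by positivity, fun r hr => hball ?_⟩
    rw [mem_ball, Real.dist_eq, sub_zero]; linarith
  -- the closed parameter sets of the faces
  set C : Finset E → Set ℝ := fun t => {r | r ∈ Icc 0 r₀ ∧ γ r ∈ convexHull ℝ (t : Set E)} with hC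
  have hCclosed : ∀ t, IsClosed (C t) := fun t =>
    isClosed_Icc.inter ((t.finite_toSet.isCompact_convexHull ℝ).isClosed.preimage hγc)
  have hcover : Ioc 0 r₀ ⊆ ⋃ t ∈ hK.toFinset, C t ∩ Ioi 0 := by
    intro r hr
    have hmem : γ r ∈ K.space := hr₀sub r (by rw [abs_of_pos hr.1]; exact hr.2)
    obtain ⟨t, ht, hrt⟩ := mem_iUnion₂.1 hmem
    exact mem_iUnion₂.2 ⟨t, hK.mem_toFinset.2 ht, ⟨⟨hr.1.le, hr.2⟩, hrt⟩, hr.1⟩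
  -- `0` lies in the closure of some `C t ∩ (0, ∞)`
  have h0cl : (0 : ℝ) ∈ closure (⋃ t ∈ hK.toFinset, C t ∩ Ioi 0) := by
    apply closure_mono hcover
    rw [closure_Ioc hr₀.ne]
    exact ⟨le_rfl, hr₀.le⟩
  rw [Finset.closure_biUnion] at h0cl
  obtain ⟨t, ht, h0t⟩ := mem_iUnion₂.1 h0cl
  have htK : t ∈ K.faces := hK.mem_toFinset.1 ht
  -- hence `x₀ ∈ conv t` and some `r > 0` has `γ r ∈ conv t`
  have hx₀t : x₀ ∈ convexHull ℝ (t : Set E) := by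
    have h := closure_mono inter_subset_left h0t
    rw [(hCclosed t).closure_eq] at h
    simpa [hγ0] using h.2
  obtain ⟨r, ⟨hrC, hrpos⟩⟩ : (C t ∩ Ioi 0).Nonempty := by
    by_contra h
    rw [not_nonempty_iff_eq_empty] at h
    rw [h, closure_empty] at h0t
    exact h0t
  -- `s ⊆ t` by positivity of the coordinates of `x₀`
  have hst : facet b i₀ ⊆ t := by
    intro v hv
    by_contra hvt
    obtain ⟨i, hi, rfl⟩ := mem_facet_iff.1 hv
    have hinter : x₀ ∈ convexHull ℝ ((facet b i₀ ∩ t : Finset E) : Set E) := by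
      rw [Finset.coe_inter, ← Geometry.SimplicialComplex.convexHull_inter_convexHull hs htK]
      exact ⟨hx₀s, hx₀t⟩
    have hsub : (facet b i₀ ∩ t : Finset E) ⊆ (facet b i₀).erase (b i) := by
      intro w hw
      rw [Finset.mem_inter] at hw
      exact Finset.mem_erase.2 ⟨fun h => hvt (h ▸ hw.2), hw.1⟩
    have h0 := coord_eq_zero_of_mem_convexHull_erase (convexHull_mono (by exact_mod_cast hsub) hinter)
    exact (hpos i hi).ne' h0
  -- a vertex of `t` on the `σ`-side
  have hval : 0 < σ * b.coord i₀ (γ r) := by rw [hℓγ, ← mul_assoc, hσsq, one_mul]; exact hrpos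
  obtain ⟨p, hpt, hpside⟩ : ∃ p ∈ t, 0 < σ * b.coord i₀ p := by
    by_contra h
    simp only [not_exists, not_and, not_lt] at h
    have hconv : Convex ℝ {y : E | σ * b.coord i₀ y ≤ 0} := by
      intro y hy z hz a c ha hc hac
      simp only [mem_setOf_eq] at hy hz ⊢
      rw [Convex.combo_affine_apply hac]
      simp only [smul_eq_mul]
      nlinarith [mul_nonneg ha (neg_nonneg.2 hy), mul_nonneg hc (neg_nonneg.2 hz)]
    have := convexHull_min (fun v hv => h v (Finset.mem_coe.1 hv)) hconv hrC.2
    exact absurd hval (not_lt.2 this)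
  have hps : p ∉ facet b i₀ := fun hp => by
    rw [coord_eq_zero_of_mem_facet hp, mul_zero] at hpside
    exact lt_irrefl _ hpside
  refine ⟨p, ?_, hpside⟩
  exact K.down_closed htK (Finset.insert_subset hpt hst) (Finset.insert_nonempty _ _)

end Literature.Topology.FourManifolds
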